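import Literature.MathematicalPhysics.QuantumFieldTheory.OSPointContinuation
import Literature.Analysis.Complex.VitaliSeveral
import HarnessLib

/-!
# Joint continuity of the continued Schwinger functions in the spatial parameters

Topic `Literature/MathematicalPhysics/QuantumFieldTheory`; support file (all proved; no new
definitions; no named facts) for the discharge of (A1) `OS1975_exists_timeContinuation`.
Osterwalder–Schrader II (Comm. Math. Phys. 42 (1975)), Ch. V.2 p. 294 ("continuity in the remaining
variables", (5.11)): the analytic continuations `Sext k c ζ` of Thm. 4.2
(`OSPointContinuation.schwinger_exists_labelledTimeContinuation`) depend continuously on the spatial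
labels `c` and the complex time differences `ζ` *jointly* — from the label-uniform local bounds, the
joint continuity of the Schwinger function values at the real points (continuity of the densities of
Thm. 4.1) and Vitali's theorem (`VitaliSeveral.tendsto_of_tendsto_ofReal`).

* `continuous_labCfg₂`, `continuousOn_pointS₀₂` — joint continuity of the labelled configuration
  and of the real-point functions in (labels, gaps);
* `exists_bound_on_compact` — the label-uniform bound on a compact subset of `ℂ₊ᵏ`;
* `continuousOn_labelledTimeContinuation` — joint continuity of `(c, ζ) ↦ Sext k c ζ` on
  `{‖cⱼ‖ < R} × ℂ₊ᵏ`.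

## References

* K. Osterwalder, R. Schrader, *Axioms for Euclidean Green's functions II*, Comm. Math. Phys.
  42 (1975) 281–305, §IV.2 Thm. 4.2; Ch. V.2 p. 294, (5.11). [OsterwalderSchraderCMP1975]
-/

noncomputable section

open Metric Set Filter Function
open _root_.Topology
open scoped InnerProductSpace

namespace Literature.MathematicalPhysics.QuantumFieldTheory

variable {d : ℕ} [NeZero d]

open Literature.MathematicalPhysics.QuantumLattice (SchwingerFamily)
open Literature.MathematicalPhysics.QuantumLattice.SchwingerFamily
open Literature.MathematicalPhysics.QuantumLattice.SchwingerFamily.OSSpace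
open Literature.MathematicalPhysics.QuantumFieldTheory.OSEnvelope
open Literature.Analysis.Complex

/-! ### Joint continuity at the real points -/

/-- The labelled configuration is jointly continuous in (labels, gaps). [folklore] -/
theorem continuous_labCfg₂ {n : ℕ} (x : ℝ) :
    Continuous fun q : (Fin (n + 1) → EuclideanSpace ℝ (Fin d)) × (Fin n → ℝ) => labCfg q.1 x q.2 := by
  refine continuous_pi fun j => ?_
  simp only [labCfg]
  have hps : Continuous fun ξ : Fin n → ℝ => Fin.partialSum ξ j := by
    simp only [partialSum_eq_sum_filter]
    exact continuous_finsetSum _ fun i _ => continuous_apply i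
  have ha : Continuous fun q : (Fin (n + 1) → EuclideanSpace ℝ (Fin d)) × (Fin n → ℝ) => q.1 j :=
    (continuous_apply j).comp continuous_fst
  have ha0 : Continuous fun q : (Fin (n + 1) → EuclideanSpace ℝ (Fin d)) × (Fin n → ℝ) => q.1 j 0 :=
    (EuclideanSpace.proj (0 : Fin d)).continuous.comp ha
  exact ha.add ((QuantumLattice.continuous_single_time d).comp
    ((continuous_const.add (hps.comp continuous_snd)).sub ha0))

variable {𝔖 : SchwingerFamily (EuclideanSpace ℝ (Fin d))}
  (hE1 : 𝔖.IsEuclideanCovariant) (hE2 : 𝔖.IsOSReflectionPositive) (hE0 : 𝔖.HasLinearGrowth)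

/-- **The real-point functions are jointly continuous in (labels, gaps)** on the positive gaps
(continuity of the densities of Thm. 4.1). [cite: OsterwalderSchraderCMP1975, §IV.2 Thm. 4.1] -/
theorem continuousOn_pointS₀₂ (k : ℕ) :
    ContinuousOn (fun q : (Fin (k + 1) → EuclideanSpace ℝ (Fin d)) × (Fin k → ℝ) =>
      pointS₀ hE1 hE2 hE0 k q.1 fun i => (q.2 i : ℂ)) (univ ×ˢ {ρ | ∀ i, 0 < ρ i}) := by
  cases k with
  | zero => exact continuousOn_const
  | succ k' =>
    have hre : ∀ ρ : Fin (k' + 1) → ℝ, (fun i => ((ρ i : ℂ)).re) = ρ := fun ρ => funext fun i => Complex.ofReal_re _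
    simp only [pointS₀, hre]
    exact (isLocalDensity_dens hE1 hE2 hE0 k').cont.comp (continuous_labCfg₂ 0).continuousOn
      fun q hq => labCfg_mem_incrTimes q.1 0 hq.2

/-! ### The label-uniform bound on compact subsets of `ℂ₊ᵏ` -/

/-- A compact subset of `ℂ₊ᵏ` lies in the argument region of a compact subcube. [folklore] -/
theorem exists_compact_argRegion {k : ℕ} {K : Set (Fin k → ℂ)} (hK : IsCompact K)
    (hKs : K ⊆ {Z | ∀ i, 0 < (Z i).re}) :
    ∃ K' : Set (Fin k → ℝ), IsCompact K' ∧ K' ⊆ {v | ∀ i, |v i| < Real.pi / 2} ∧ K ⊆ argRegion K' := by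
  set φ : (Fin k → ℂ) → Fin k → ℝ := fun Z i => (Z i).arg with hφ
  have hφc : ContinuousOn φ {Z | ∀ i, 0 < (Z i).re} := by
    refine continuousOn_pi.2 fun i => ?_
    intro Z hZ
    exact (ContinuousAt.comp (f := fun Z : Fin k → ℂ => Z i) (Complex.continuousAt_arg (Or.inl (hZ i)))
      (continuous_apply i).continuousAt).continuousWithinAt
  refine ⟨φ '' K, hK.image_of_continuousOn (hφc.mono hKs), ?_, fun Z hZ => ⟨hKs hZ, mem_image_of_mem φ hZ⟩⟩
  rintro _ ⟨Z, hZ, rfl⟩ i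
  exact Complex.abs_arg_lt_pi_div_two_iff.2 (Or.inl (hKs hZ i))

/-- `gFactor` is bounded on compact subsets of `ℂ₊ᵏ`. [folklore] -/
theorem exists_gFactor_le {k : ℕ} {K : Set (Fin k → ℂ)} (hK : IsCompact K) (hKs : K ⊆ {Z | ∀ i, 0 < (Z i).re}) :
    ∃ G : ℝ, 0 ≤ G ∧ ∀ Z ∈ K, gFactor Z ≤ G := by
  have hc : ContinuousOn (fun Z : Fin k → ℂ => gFactor Z) {Z | ∀ i, 0 < (Z i).re} := by
    simp only [gFactor]
    refine continuousOn_finsetProd _ fun i _ => ?_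
    have hn : Continuous fun Z : Fin k → ℂ => ‖Z i‖ := continuous_norm.comp (continuous_apply i)
    refine hn.continuousOn.add (hn.continuousOn.inv₀ fun Z hZ => ?_)
    exact (norm_pos_iff.2 fun h => by have := hZ i; rw [h] at this; simp at this).ne'
  obtain ⟨G, hG⟩ := hK.exists_bound_of_continuousOn (hc.mono hKs)
  refine ⟨max G 0, le_max_right _ _, fun Z hZ => ?_⟩
  have h := hG Z hZ
  rw [Real.norm_eq_abs] at h
  exact (le_abs_self _).trans (h.trans (le_max_left _ _))

/-! ### Joint continuity -/

/-- **Joint continuity of the continued Schwinger functions in the spatial labels and the complex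
time differences** (OS II Ch. V.2 p. 294): for the family of
`schwinger_exists_labelledTimeContinuation` (any family holomorphic on `ℂ₊ᵏ` for the labels in the
ball of radius `R`, equal to `pointS₀` at the real points, with the label-uniform local bounds), the
map `(c, ζ) ↦ Sext k c ζ` is continuous on `{‖cⱼ‖ < R} × ℂ₊ᵏ`, `k ≥ 1`. [cite: OsterwalderSchraderCMP1975, Ch. V.2 p. 294, (5.11)] -/
theorem continuousOn_labelledTimeContinuation {R : ℝ} {k : ℕ} (hk : 0 < k)
    {Sext : (k : ℕ) → (Fin (k + 1) → EuclideanSpace ℝ (Fin d)) → (Fin k → ℂ) → ℂ}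
    (hhol : ∀ (k : ℕ) (c : Fin (k + 1) → EuclideanSpace ℝ (Fin d)), normBall R k c → 0 < k →
      DifferentiableOn ℂ (Sext k c) {Z | ∀ i, 0 < (Z i).re})
    (hreal : ∀ (k : ℕ) (c : Fin (k + 1) → EuclideanSpace ℝ (Fin d)), 0 < k → ∀ ρ : Fin k → ℝ, (∀ i, 0 < ρ i) →
      Sext k c (fun i => (ρ i : ℂ)) = pointS₀ hE1 hE2 hE0 k c (fun i => (ρ i : ℂ)))
    {Cb : Set (Fin k → ℝ) → ℝ} {eb : Set (Fin k → ℝ) → ℕ}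
    (hbd : ∀ (c : Fin (k + 1) → EuclideanSpace ℝ (Fin d)), normBall R k c →
      ∀ K : Set (Fin k → ℝ), IsCompact K → K ⊆ {v | ∀ i, |v i| < Real.pi / 2} →
        ∀ Z ∈ argRegion K, ‖Sext k c Z‖ ≤ Cb K * gFactor Z ^ eb K) :
    ContinuousOn (fun q : (Fin (k + 1) → EuclideanSpace ℝ (Fin d)) × (Fin k → ℂ) => Sext k q.1 q.2)
      ({c | ∀ j, ‖c j‖ < R} ×ˢ {Z | ∀ i, 0 < (Z i).re}) := by
  rw [continuousOn_iff_continuous_restrict, continuous_iff_seqContinuous]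
  intro u q hu
  -- the sequence of labels and points
  have huq : Tendsto (fun m => (u m).1) atTop (𝓝 q.1) := (continuous_subtype_val.tendsto q).comp hu
  have hc : Tendsto (fun m => (u m).1.1) atTop (𝓝 q.1.1) := (continuous_fst.tendsto _).comp huq
  have hZ : Tendsto (fun m => (u m).1.2) atTop (𝓝 q.1.2) := (continuous_snd.tendsto _).comp huq
  have hcm : ∀ m, normBall R k (u m).1.1 := fun m j => le_of_lt ((u m).2.1 j)
  have hcq : normBall R k q.1.1 := fun j => le_of_lt (q.2.1 j)
  show Tendsto (fun m => Sext k (u m).1.1 (u m).1.2) atTop (𝓝 (Sext k q.1.1 q.1.2))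
  refine tendsto_of_tendsto_ofReal (F := fun m => Sext k (u m).1.1) (f := Sext k q.1.1)
    (fun m => hhol k _ (hcm m) hk) (hhol k _ hcq hk) (fun K hKs hK => ?_) (fun ρs ρ hρs hρ hlim => ?_)
    (fun m => (u m).2.2) q.2.2 hZ
  · -- the label-uniform bound on `K`
    obtain ⟨K', hK'c, hK's, hKK'⟩ := exists_compact_argRegion hK hKs
    obtain ⟨G, hG0, hG⟩ := exists_gFactor_le hK hKs
    refine ⟨max (Cb K') 0 * G ^ eb K', fun m W hW => (hbd _ (hcm m) K' hK'c hK's W (hKK' hW)).trans ?_⟩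
    have hg0 : 0 ≤ gFactor W := by rw [gFactor]; exact Finset.prod_nonneg fun i _ => by positivity
    exact mul_le_mul (le_max_left _ _) (pow_le_pow_left₀ hg0 (hG W hW) _) (by positivity) (le_max_right _ _)
  · -- convergence at the real points: continuity of the densities
    have h1 : ∀ m, Sext k (u m).1.1 (fun i => (ρs m i : ℂ)) = pointS₀ hE1 hE2 hE0 k (u m).1.1 fun i => (ρs m i : ℂ) :=
      fun m => hreal k _ hk (ρs m) (hρs m)
    have h2 : Sext k q.1.1 (fun i => (ρ i : ℂ)) = pointS₀ hE1 hE2 hE0 k q.1.1 fun i => (ρ i : ℂ) :=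
      hreal k _ hk ρ hρ
    simp only [h1, h2]
    have hcont := continuousOn_pointS₀₂ hE1 hE2 hE0 k
    have hmem : (q.1.1, ρ) ∈ (univ : Set (Fin (k + 1) → EuclideanSpace ℝ (Fin d))) ×ˢ {ρ : Fin k → ℝ | ∀ i, 0 < ρ i} :=
      ⟨mem_univ _, hρ⟩
    have hpair : Tendsto (fun m => ((u m).1.1, ρs m)) atTop
        (𝓝[(univ : Set (Fin (k + 1) → EuclideanSpace ℝ (Fin d))) ×ˢ {ρ : Fin k → ℝ | ∀ i, 0 < ρ i}] (q.1.1, ρ)) :=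
      tendsto_nhdsWithin_iff.2 ⟨hc.prodMk_nhds hlim, Eventually.of_forall fun m => ⟨mem_univ _, hρs m⟩⟩
    exact ((hcont _ hmem).tendsto).comp hpair

end Literature.MathematicalPhysics.QuantumFieldTheory
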